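import Summits.HodgeConjecture.HodgeConjecture.Theorems.K2E1TraceFormulaBetaDefs   -- ★ p854778 DEFS LEAF: `Pl`∕`HLoc`∕`GLoc`, `StSpectralHypLetter`, `StGlobKit` + `Law…`, `lawUnitary_of_lawDiscrete`, `E1St1383Letter`
import Literature.NumberTheory.GaloisRepresentations.HeckeCharacter                    -- ★ `HeckeCharacter.IsUnramifiedAt` (the ⟪U⟫ binder of R-b′)
import Mathlib.RingTheory.Unramified.LocalRing                                          -- Mathlib `Algebra.IsUnramifiedAt` (the ⟪U⟫ binder of R-b′)
import HarnessLib

/-!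
# K2·E1 (U1-E1) — THE TWO E1 LETTERS READ AT ONE INSTANCE `(L, μ, ξ, v)`: `St1383At`, `StSpectralHypAt`, the pointwise read-off `St1383At → StSpectralHypAt`,
# and the ⟪U⟫-restricted engine letter `E1St1383LetterUnr` (J-S10∕E1-U, chain (U-loc) of record)

Cell `hodgecm-mathlib`, crux H413 (`stmt-HodgeConjecture-24833`), route of record `HCCMUnconditional`; squad K2, engine E1; R90-TF LEAD ∕ E1 dealer K2E1-plan (g8)
LEAD #32 (H)+(N) 2026-09-04T22:23:06Z, DEAL (U1-E1) → K2E4-p14 (g11).  Lane `--supports stmt-HodgeConjecture-24833 --as helper` (definition lane, review-queued: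
three `def … : Prop` + theorems; no instance, no notation, no axiom, no `sorry`); imports the ★ DEFS LEAF only (+ the two modules the ⟪U⟫ binder names) — a `Theorems/`
file never imports `Cruxes/…/Lines` (the workfile `Lines/K2_E1_TraceFormulaBeta.lean` keeps its own §Regroup; this file re-proves it under ITS OWN namespace, so no
fully-qualified name is declared twice).

WHAT AND WHY [Rogawski1990 §13.8 proof of Prop. 13.8.3, pp. 218–219; Lemma 12.7.2 p. 191].  The ★ leaf states E1's two letters as CLOSED `Prop`s quantified over
`(L, μ, ξ, v)`: the engine output «St-(13.8.3)» `E1St1383Letter` and the organ letter (S-β) `StSpectralHypLetter`.  J-S10∕E1-U (LEAD #32 (H), S10 RULING F-A1 = R-b′):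
S10 pays the engine letter only on print's regime ⟪U⟫ «`L∕L⁺` and `μ` unramified at every finite `w ≠ v`» [p. 218 l. 12; Prop. 4.9.1 (b)], and reaches (S-β) for ALL
`(L, μ, ξ, v)` by the chain (U-loc): ⟪U⟫-instances ⟹ `St1383At` ⟹ (pointwise read-off, THIS FILE) `StSpectralHypAt` ⟹ (S10's transport (U2) + globalisation (U3)
sockets over S3's currency) `StSpectralHypLetter`.  For that chain both letters must be readable AT ONE INSTANCE — hence:
* §1 **`St1383At L μ ξ v`**, **`StSpectralHypAt L μ ξ v`** — the bodies of ★ `E1St1383Letter` ∕ ★ `StSpectralHypLetter` after the binders `L [..] μ ξ v`, TOKEN FOR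
  TOKEN (statement bytes of both ★ letters FROZEN; the byte guards `e1St1383Letter_iff` ∕ `stSpectralHypLetter_iff` are `Iff.rfl`).
* §2 §Regroup re-proved here (`fibreSum`, `exists_of_fibreSum_ne_zero`, `hasSum_fibreSum` — Mathlib `Equiv.sigmaFiberEquiv`, `HasSum.sigma`): print's
  «`a(π_w) = Σ_{π ↦ π_w} m(π) ε_π`» regrouping of an absolutely convergent sum by FINITE fibres [p. 219].
* §3 **`stSpectralHypAt_of_st1383At : St1383At L μ ξ v → StSpectralHypAt L μ ξ v`** — the body of the workfile's `stSpectralHyp_of_line` read at one instance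
  (countable support ⊆ image of the countable index; unitarizable members from `LawDiscrete` via ★ `lawUnitary_of_lawDiscrete`; the identity regrouped by
  `hasSum_fibreSum`); corollary `stSpectralHypLetter_of_e1St1383Letter` (the workfile's theorem, recovered).
* §4 **`E1St1383LetterUnr : Prop := ∀ L _ _ _ μ ξ v, ⟪U⟫ → h3 → St1383At L μ ξ v`** (h3 = `3 ≤ [L⁺:ℚ]`, R-U2 — S10's two-place archimedean device; bytes of record
  «⟪U⟫ THEN h3» = S10 A v4 :544–:545, importer flag (F1) 22:32Z) with ⟪U⟫ = R-b′'s EXACT line (S10 `RULING-S10-FA1.v1.md` 305388d63059cf0d §1, farm-probed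
  `UnrBinderProbe.lean` 5345b8607569b7f5): `∀ w : Pl L, w ≠ v → ∀ W : PlacesOver L w, Algebra.IsUnramifiedAt (𝓞 L⁺) W.1.asIdeal ∧ μ.IsUnramifiedAt W.1`;
  `e1St1383LetterUnr_of_letter : E1St1383Letter → E1St1383LetterUnr` (drop ⟪U⟫) and `stSpectralHypUnr_of_unr : E1St1383LetterUnr → ∀ …, ⟪U⟫ → StSpectralHypAt …`.
HONEST LABEL: definitions and a regrouping lemma; no engine content is proved here (the engine letter stays S10's head on ⟪U⟫ + J-S10∕E1-U); HC_CM is proved only modulo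
the 7 printed citations (2 remaining named inputs: hLiu418 = stmt-HodgeConjecture-24832, h413 = stmt-HodgeConjecture-24833) until rung 0 closes.

## References
* [Rogawski1990] J. D. Rogawski, *Automorphic Representations of Unitary Groups in Three Variables*, Ann. of Math. Stud. 123 (1990), §13.8 Prop. 13.8.3 (proof)
  pp. 218–219, display (13.8.3), p. 218 l. 12 («unramified … outside v»); §12.7 Lemma 12.7.2 p. 191; §4.9 Prop. 4.9.1 (b) p. 53.
* [BorelJacquet1979] A. Borel, H. Jacquet, *Automorphic forms and automorphic representations*, Corvallis I (1979), §4.6.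
-/

set_option autoImplicit false
-- the mandated namespace repeats the single-problem summit's segment (`HodgeConjecture.HodgeConjecture`)
set_option linter.dupNamespace false

noncomputable section

open NumberField IsDedekindDomain MeasureTheory
open scoped Matrix MatrixGroups
open Literature.NumberTheory.Rogawski1990 Literature.NumberTheory.Automorphic Literature.NumberTheory.Automorphic.UnitaryGroup
open Literature.NumberTheory.Automorphic.UnitaryGroup.CotangentForms Literature.NumberTheory.GaloisRepresentations
open Literature.NumberTheory.Automorphic.Arthur2013.Leaves.TECR
open Summit.HodgeConjecture.HodgeConjecture.Cruxes.H413.F0P3GlobalPacketDiscrete (cmOccursInDiscreteSpectrum isUnitarizable_of_cmOccursInDiscreteSpectrum)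
open Summit.HodgeConjecture.HodgeConjecture.Cruxes.H413.K2E1TraceFormulaBeta

namespace Summit.HodgeConjecture.HodgeConjecture.Cruxes.H413.K2E1StSpectralHypAtOfSt1383At

/-! ## §1 The two letters at one instance `(L, μ, ξ, v)` -/

/-- **`St1383At L μ ξ v` — E1's LETTER «St-(13.8.3)» READ AT ONE INSTANCE**: the body of ★ `E1St1383Letter` after its binders `L [..] μ ξ v`, token for token
(`e1St1383Letter_iff` is `Iff.rfl`).  Rogawski's identity (13.8.3) for the globalised `St_H(ξ_v)` on restricted test functions, read at `v`: an automorphic measure,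
an index kit with the laws COUNTABLE · DISCRETE · SIGNS · FINITE FIBRES, and `Σ' m(π) ε_π Tr π_v(φ) = Tr St_H(ξ_v)(f^H)` absolutely, for every smooth matched pair at `v`.
[cite: Rogawski1990, §13.8 Prop. 13.8.3 (proof) pp. 218–219, display (13.8.3)] [cite: BorelJacquet1979, §4.6] -/
def St1383At (L : Type) [Field L] [NumberField L] [IsCMField L] (μ : HeckeCharacter L) (ξ : OneDimAutRepH L) (v : Pl L) : Prop :=
    (∀ w : PlacesOver L v, IsCMField.complexConj L • w.1 = w.1) → μ.IsUnitary →
    (∀ x : Literature.NumberTheory.GaloisRepresentations.ideleGroup ↥(maximalRealSubfield L),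
      μ (AdeleRing.ideleBaseChange (↥(maximalRealSubfield L)) L x) = quadraticHeckeCharCM L x) →
    ∀ [MeasurableSpace (HLoc L v)] [BorelSpace (HLoc L v)] [MeasurableSpace (Gqs L v)] [BorelSpace (Gqs L v)]
      (νHv : Measure (HLoc L v)) (νQv : Measure (Gqs L v))
      [νHv.IsHaarMeasure] [νHv.IsMulRightInvariant] [νQv.IsHaarMeasure] [νQv.IsMulRightInvariant],
    letI : ∀ a : HLoc L v, MeasurableSpace (HLoc L v ⧸ Subgroup.centralizer ({a} : Set (HLoc L v))) := fun _ => borel _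
    haveI : ∀ a : HLoc L v, BorelSpace (HLoc L v ⧸ Subgroup.centralizer ({a} : Set (HLoc L v))) := fun _ => ⟨rfl⟩
    letI : ∀ γ : Gqs L v, MeasurableSpace (Gqs L v ⧸ Subgroup.centralizer ({γ} : Set (Gqs L v))) := fun _ => borel _
    haveI : ∀ γ : Gqs L v, BorelSpace (Gqs L v ⧸ Subgroup.centralizer ({γ} : Set (Gqs L v))) := fun _ => ⟨rfl⟩
    ∀ (mHv : OrbitalMeasureFamily (HLoc L v)) (mQv : OrbitalMeasureFamily (Gqs L v)),
      mHv.IsCanonical (IsLocalGRegular L v) νHv →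
      mQv.IsCanonical (fun γ => IsRegularElt (γ.val : GL (Fin 3) (UnitaryGroup.LocalRing L v))) νQv →
      ∀ (π₁ πSt : IrrClass (HLoc L v)),
        HLengthTwoLabels L v
          (torusCharPair (conjLocal L (IsCMField.complexConj L) v) (cmLocalForm L 2 v) (cmLocalForm_eq_over L 2 v) 0
            ((torusLocalComponent L (IsCMField.complexConj L) v ξ.η).comp
                (quotConj (conjLocal L (IsCMField.complexConj L) v) (conjLocal_conjLocal_cm L v)) *
              halfModulusChar (UnitaryGroup.LocalRing L v))
            (torusLocalComponent L (IsCMField.complexConj L) v ξ.ψ))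
          ((torusLocalComponent L (IsCMField.complexConj L) v ξ.ψ).comp (localDet (IsCMField.complexConj L) v (isUnit_antidiagOne_det L 1))) π₁ πSt →
        (∀ fH : HLoc L v → ℂ, IsLocSmooth fH → π₁.smoothTrace νHv fH = charDist (ξ.xiLocalChar v) νHv fH) →
        ∃ (μG : Measure (adelicGroupData (↥(maximalRealSubfield L)) L (IsCMField.complexConj L) 3 (qsForm L)).automorphicQuotient)
          (_ : (adelicGroupData (↥(maximalRealSubfield L)) L (IsCMField.complexConj L) 3 (qsForm L)).IsAutomorphicMeasure μG)
          (𝔨 : StGlobKit L),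
          𝔨.LawCountable ∧ 𝔨.LawDiscrete μG ∧ 𝔨.LawSigns ∧ 𝔨.LawFibreFinite v ∧
          ∀ (fH : HLoc L v → ℂ) (φ : Gqs L v → ℂ), IsLocSmooth fH → IsLocSmooth φ →
            IsLocalDeltaTransfer L (qsForm L) v ((finExplicitCollection L (qsForm L) μ (finExplicitDelta_conj_left_all L (qsForm L) μ) (finExplicitDelta_conj_right_all L (qsForm L) μ)) v) mHv mQv fH φ →
            Summable (fun i : 𝔨.Idx => (𝔨.mult i : ℂ) * (𝔨.eps i : ℂ) * (𝔨.loc i v).smoothTrace νQv φ) ∧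
              ∑' i : 𝔨.Idx, (𝔨.mult i : ℂ) * (𝔨.eps i : ℂ) * (𝔨.loc i v).smoothTrace νQv φ = πSt.smoothTrace νHv fH

/-- **`StSpectralHypAt L μ ξ v` — THE LETTER (S-β) READ AT ONE INSTANCE**: the body of ★ `StSpectralHypLetter` after its binders `L [..] μ ξ v`, token for token
(`stSpectralHypLetter_iff` is `Iff.rfl`).  Hypothesis (β) of Lemma 12.7.2 for `ρ = St_H(ξ_v)` on `U(Φ₃)(L⁺_v)`: an integer-valued `aX` with countable support and
unitarizable members such that `Σ' aX(π) Tr π(φ) = Tr St_H(ξ_v)(f^H)` absolutely for every smooth matched pair.  LOCAL AT `v` IN CONTENT (no automorphic measure).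
[cite: Rogawski1990, Lemma 12.7.2 p. 191; §13.8 Prop. 13.8.3 (proof) pp. 218–219] -/
def StSpectralHypAt (L : Type) [Field L] [NumberField L] [IsCMField L] (μ : HeckeCharacter L) (ξ : OneDimAutRepH L) (v : Pl L) : Prop :=
    (∀ w : PlacesOver L v, IsCMField.complexConj L • w.1 = w.1) → μ.IsUnitary →
    (∀ x : Literature.NumberTheory.GaloisRepresentations.ideleGroup ↥(maximalRealSubfield L),
      μ (AdeleRing.ideleBaseChange (↥(maximalRealSubfield L)) L x) = quadraticHeckeCharCM L x) →
    ∀ [MeasurableSpace (HLoc L v)] [BorelSpace (HLoc L v)] [MeasurableSpace (Gqs L v)] [BorelSpace (Gqs L v)]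
      (νHv : Measure (HLoc L v)) (νQv : Measure (Gqs L v))
      [νHv.IsHaarMeasure] [νHv.IsMulRightInvariant] [νQv.IsHaarMeasure] [νQv.IsMulRightInvariant],
    letI : ∀ a : HLoc L v, MeasurableSpace (HLoc L v ⧸ Subgroup.centralizer ({a} : Set (HLoc L v))) := fun _ => borel _
    haveI : ∀ a : HLoc L v, BorelSpace (HLoc L v ⧸ Subgroup.centralizer ({a} : Set (HLoc L v))) := fun _ => ⟨rfl⟩
    letI : ∀ γ : Gqs L v, MeasurableSpace (Gqs L v ⧸ Subgroup.centralizer ({γ} : Set (Gqs L v))) := fun _ => borel _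
    haveI : ∀ γ : Gqs L v, BorelSpace (Gqs L v ⧸ Subgroup.centralizer ({γ} : Set (Gqs L v))) := fun _ => ⟨rfl⟩
    ∀ (mHv : OrbitalMeasureFamily (HLoc L v)) (mQv : OrbitalMeasureFamily (Gqs L v)),
      mHv.IsCanonical (IsLocalGRegular L v) νHv →
      mQv.IsCanonical (fun γ => IsRegularElt (γ.val : GL (Fin 3) (UnitaryGroup.LocalRing L v))) νQv →
      ∀ (π₁ πSt : IrrClass (HLoc L v)),
        HLengthTwoLabels L v
          (torusCharPair (conjLocal L (IsCMField.complexConj L) v) (cmLocalForm L 2 v) (cmLocalForm_eq_over L 2 v) 0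
            ((torusLocalComponent L (IsCMField.complexConj L) v ξ.η).comp
                (quotConj (conjLocal L (IsCMField.complexConj L) v) (conjLocal_conjLocal_cm L v)) *
              halfModulusChar (UnitaryGroup.LocalRing L v))
            (torusLocalComponent L (IsCMField.complexConj L) v ξ.ψ))
          ((torusLocalComponent L (IsCMField.complexConj L) v ξ.ψ).comp (localDet (IsCMField.complexConj L) v (isUnit_antidiagOne_det L 1))) π₁ πSt →
        (∀ fH : HLoc L v → ℂ, IsLocSmooth fH → π₁.smoothTrace νHv fH = charDist (ξ.xiLocalChar v) νHv fH) →
        ∃ aX : IrrClass (Gqs L v) → ℤ, (Function.support aX).Countable ∧ (∀ π : IrrClass (Gqs L v), aX π ≠ 0 → π.IsUnitarizable) ∧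
          ∀ (fH : HLoc L v → ℂ) (φ : Gqs L v → ℂ), IsLocSmooth fH → IsLocSmooth φ →
            IsLocalDeltaTransfer L (qsForm L) v ((finExplicitCollection L (qsForm L) μ (finExplicitDelta_conj_left_all L (qsForm L) μ) (finExplicitDelta_conj_right_all L (qsForm L) μ)) v) mHv mQv fH φ →
            Summable (fun π : IrrClass (Gqs L v) => (aX π : ℂ) * π.smoothTrace νQv φ) ∧
              ∑' π : IrrClass (Gqs L v), (aX π : ℂ) * π.smoothTrace νQv φ = πSt.smoothTrace νHv fH

/-- BYTE GUARD: ★ `E1St1383Letter` IS `∀ (L, μ, ξ, v), St1383At L μ ξ v` — definitionally (`Iff.rfl`). [cite: Rogawski1990, §13.8 display (13.8.3) p. 218] -/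
theorem e1St1383Letter_iff :
    E1St1383Letter ↔ ∀ (L : Type) [Field L] [NumberField L] [IsCMField L] (μ : HeckeCharacter L) (ξ : OneDimAutRepH L) (v : Pl L), St1383At L μ ξ v :=
  Iff.rfl

/-- BYTE GUARD: ★ `StSpectralHypLetter` IS `∀ (L, μ, ξ, v), StSpectralHypAt L μ ξ v` — definitionally (`Iff.rfl`). [cite: Rogawski1990, Lemma 12.7.2 p. 191] -/
theorem stSpectralHypLetter_iff :
    StSpectralHypLetter ↔ ∀ (L : Type) [Field L] [NumberField L] [IsCMField L] (μ : HeckeCharacter L) (ξ : OneDimAutRepH L) (v : Pl L), StSpectralHypAt L μ ξ v :=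
  Iff.rfl

/-! ## §2 Regrouping an absolutely convergent sum by finite fibres [p. 219] -/

section Regroup

variable {I : Type*} {C : Type*} (p : I → C)

/-- The fibre-regrouped integer coefficient `a(c) := Σ_{i ↦ c} b(i)` of an integer family with finite fibres (print's `a(π_w) = Σ_{π ↦ π_w} m(π) ε_π`).
[cite: Rogawski1990, §13.8 p. 219] -/
def fibreSum (b : I → ℤ) (hfin : ∀ c : C, {i : I | p i = c}.Finite) (c : C) : ℤ :=
  ∑ i ∈ (hfin c).toFinset, b i

/-- If `fibreSum … c ≠ 0` the fibre over `c` is inhabited. [cite: Rogawski1990, §13.8 p. 219] -/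
theorem exists_of_fibreSum_ne_zero (b : I → ℤ) (hfin : ∀ c : C, {i : I | p i = c}.Finite) {c : C}
    (h : fibreSum p b hfin c ≠ 0) : ∃ i : I, p i = c := by
  by_contra hne
  push Not at hne
  apply h
  unfold fibreSum
  exact Finset.sum_eq_zero (fun i hi => absurd ((hfin c).mem_toFinset.mp hi) (hne i))

/-- **Regrouping an absolutely convergent sum by finite fibres**: if `i ↦ b(i)·T(p i)` has sum `s`, then `c ↦ a(c)·T(c)` has sum `s`, where
`a = fibreSum` (Mathlib `Equiv.sigmaFiberEquiv`, `HasSum.sigma`, `hasSum_fintype`, `Finset.sum_subtype`). [cite: Rogawski1990, §13.8 p. 219] -/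
theorem hasSum_fibreSum (b : I → ℤ) (hfin : ∀ c : C, {i : I | p i = c}.Finite) (T : C → ℂ) {s : ℂ}
    (h : HasSum (fun i : I => (b i : ℂ) * T (p i)) s) :
    HasSum (fun c : C => (fibreSum p b hfin c : ℂ) * T c) s := by
  classical
  have h1 : HasSum ((fun i : I => (b i : ℂ) * T (p i)) ∘ (Equiv.sigmaFiberEquiv p)) s :=
    (Equiv.hasSum_iff (Equiv.sigmaFiberEquiv p)).mpr h
  refine h1.sigma (fun c => ?_)
  haveI : Fintype {i : I // p i = c} := (hfin c).fintype
  have e : (fibreSum p b hfin c : ℂ) * T c = ∑ x : {i : I // p i = c}, (b x.1 : ℂ) * T (p x.1) := by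
    rw [fibreSum, Int.cast_sum, Finset.sum_mul,
      Finset.sum_subtype ((hfin c).toFinset) (p := fun i => p i = c) (fun i => by simp) (fun i => (b i : ℂ) * T c)]
    exact Finset.sum_congr rfl (fun x _ => by rw [x.2])
  rw [e]
  exact hasSum_fintype _

end Regroup

/-! ## §3 The pointwise read-off `St1383At → StSpectralHypAt` [p. 219: «Σ a(π_w) Tr(π_w(f_w)) = Tr(ρ₀(f_w^H)) for some a(π_w) ∈ ℤ»] -/

/-- **(G5) AT ONE INSTANCE: E1's «St-(13.8.3)» letter at `(L, μ, ξ, v)` implies the letter (S-β) at `(L, μ, ξ, v)`** — `aX(π_v) := Σ_{π ↦ π_v} m(π) ε_π` (finite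
fibres); countable support (inside the image of the countable index), unitarizable members (★ `lawUnitary_of_lawDiscrete`), and the identity regrouped by
`hasSum_fibreSum`.  The body of the workfile's `stSpectralHyp_of_line`, read at one instance. [cite: Rogawski1990, §13.8 Prop. 13.8.3 (proof) p. 219; Lemma 12.7.2 p. 191] [cite: BorelJacquet1979, §4.6] -/
theorem stSpectralHypAt_of_st1383At (L : Type) [Field L] [NumberField L] [IsCMField L] (μ : HeckeCharacter L) (ξ : OneDimAutRepH L) (v : Pl L)
    (h : St1383At L μ ξ v) : StSpectralHypAt L μ ξ v := by
  intro hv hμu hμq _ _ _ _ νHv νQv _ _ _ _ mHv mQv hmH hmQ π₁ πSt hlab hπ₁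
  obtain ⟨μG, hμG, 𝔨, hcnt, hdisc, hsgn, hfib, hid⟩ := h hv hμu hμq νHv νQv mHv mQv hmH hmQ π₁ πSt hlab hπ₁
  have hunit : 𝔨.LawUnitary := 𝔨.lawUnitary_of_lawDiscrete μG hdisc
  have hfib' : ∀ π : IrrClass (Gqs L v), {i : 𝔨.Idx | 𝔨.loc i v = π}.Finite := hfib
  refine ⟨fibreSum (fun i : 𝔨.Idx => 𝔨.loc i v) (fun i => (𝔨.mult i : ℤ) * 𝔨.eps i) hfib', ?_, ?_, ?_⟩
  · -- countable support: inside the range of the `v`-component map of the countable index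
    haveI : Countable 𝔨.Idx := hcnt
    refine (Set.countable_range (fun i : 𝔨.Idx => 𝔨.loc i v)).mono (fun π hπ => ?_)
    obtain ⟨i, hi⟩ := exists_of_fibreSum_ne_zero _ _ hfib' (Function.mem_support.mp hπ)
    exact ⟨i, hi⟩
  · -- members are unitarizable: they are `v`-components of discrete automorphic `π`
    intro π hπ
    obtain ⟨i, rfl⟩ := exists_of_fibreSum_ne_zero _ _ hfib' hπ
    exact hunit i v
  · intro fH φ hfH hφ htr
    obtain ⟨hsum, heq⟩ := hid fH φ hfH hφ htr
    have h0 : HasSum (fun i : 𝔨.Idx => (((𝔨.mult i : ℤ) * 𝔨.eps i : ℤ) : ℂ) * (𝔨.loc i v).smoothTrace νQv φ)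
        (πSt.smoothTrace νHv fH) := by
      rw [← heq]
      refine hsum.hasSum.congr_fun (fun i => ?_)
      push_cast
      ring
    have hreg := hasSum_fibreSum (fun i : 𝔨.Idx => 𝔨.loc i v) (fun i => (𝔨.mult i : ℤ) * 𝔨.eps i) hfib'
      (fun π => π.smoothTrace νQv φ) h0
    exact ⟨hreg.summable, hreg.tsum_eq⟩

/-- The workfile's (G5) RECOVERED from the pointwise read-off: `E1St1383Letter → StSpectralHypLetter`. [cite: Rogawski1990, §13.8 Prop. 13.8.3 (proof) pp. 218–219] -/
theorem stSpectralHypLetter_of_e1St1383Letter (hE1 : E1St1383Letter) : StSpectralHypLetter :=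
  fun L _ _ _ μ ξ v => stSpectralHypAt_of_st1383At L μ ξ v (hE1 L μ ξ v)

/-! ## §4 The ⟪U⟫-restricted engine letter (J-S10∕E1-U, chain (U-loc) of record) -/

/-- **`E1St1383LetterUnr` — E1's «St-(13.8.3)» letter RESTRICTED TO PRINT'S REGIME ⟪U⟫** «`L∕L⁺` and `μ` unramified at every finite place `w ≠ v` of `L⁺`» (the
hypotheses of Prop. 4.9.1 (b) — fundamental lemma for units — at every `w ≠ v`, under which print's globalisation chooses `f_w` = unit, p. 218 l. 12): for every
`(L, μ, ξ, v)` satisfying ⟪U⟫ (R-b′'s exact binder: `Algebra.IsUnramifiedAt (𝓞 L⁺) W.1.asIdeal ∧ μ.IsUnramifiedAt W.1` for every place `W` of `L` over every `w ≠ v`),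
and h3 `3 ≤ [L⁺ : ℚ]` (R-U2: two archimedean places for the simple-trace-formula device; bytes «⟪U⟫ then h3» = S10 A v4), `St1383At L μ ξ v`.  S10's head of record pays
exactly this; the complement regime (and small `[L⁺:ℚ]`) is reached by transport + globalisation (J-S10∕E1-U, (U3) supplies an auxiliary `L′` with `[L′⁺:ℚ] ≥ 3`).
GATE NOTE: a route-posited statement (E1's engine letter on a regime), NOT a published fact — its citation is spelled `(print: …)` exactly as the ★ DEFS LEAF does for
`E1St1383Letter`, so the gate's inline-fact relocation leaves this closed `Prop` in place.
(print: Rogawski1990, §13.8 Prop. 13.8.3 (proof) p. 218 l. 12, display (13.8.3); §4.9 Prop. 4.9.1 (b) p. 53) -/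
def E1St1383LetterUnr : Prop :=
  ∀ (L : Type) [Field L] [NumberField L] [IsCMField L] (μ : HeckeCharacter L) (ξ : OneDimAutRepH L) (v : Pl L),
    (∀ w : Pl L, w ≠ v → ∀ W : PlacesOver L w, Algebra.IsUnramifiedAt (𝓞 ↥(maximalRealSubfield L)) W.1.asIdeal ∧ μ.IsUnramifiedAt W.1) →
    (3 ≤ Module.finrank ℚ ↥(maximalRealSubfield L)) →
    St1383At L μ ξ v

/-- Unfolding `E1St1383LetterUnr` (`Iff.rfl`). [cite: Rogawski1990, §13.8 p. 218 l. 12] -/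
theorem e1St1383LetterUnr_iff :
    E1St1383LetterUnr ↔ ∀ (L : Type) [Field L] [NumberField L] [IsCMField L] (μ : HeckeCharacter L) (ξ : OneDimAutRepH L) (v : Pl L),
      (∀ w : Pl L, w ≠ v → ∀ W : PlacesOver L w, Algebra.IsUnramifiedAt (𝓞 ↥(maximalRealSubfield L)) W.1.asIdeal ∧ μ.IsUnramifiedAt W.1) →
      (3 ≤ Module.finrank ℚ ↥(maximalRealSubfield L)) →
      St1383At L μ ξ v :=
  Iff.rfl

/-- The unrestricted engine letter implies the ⟪U⟫-restricted one (drop ⟪U⟫ and h3). [cite: Rogawski1990, §13.8 Prop. 13.8.3 (proof) pp. 218–219] -/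
theorem e1St1383LetterUnr_of_letter (hE1 : E1St1383Letter) : E1St1383LetterUnr :=
  fun L _ _ _ μ ξ v _ _ => hE1 L μ ξ v

/-- **(U-loc) FIRST LINK: on ⟪U⟫-instances (with h3) the letter (S-β) holds pointwise** — `E1St1383LetterUnr ⟹ ∀ (L, μ, ξ, v), ⟪U⟫ → h3 → StSpectralHypAt L μ ξ v`
(`stSpectralHypAt_of_st1383At` under ⟪U⟫); S10's (U2) transport + (U3) globalisation carry it to `StSpectralHypLetter`. [cite: Rogawski1990, §13.8 Prop. 13.8.3 (proof) pp. 218–219; Lemma 12.7.2 p. 191] -/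
theorem stSpectralHypUnr_of_unr (hU : E1St1383LetterUnr) :
    ∀ (L : Type) [Field L] [NumberField L] [IsCMField L] (μ : HeckeCharacter L) (ξ : OneDimAutRepH L) (v : Pl L),
      (∀ w : Pl L, w ≠ v → ∀ W : PlacesOver L w, Algebra.IsUnramifiedAt (𝓞 ↥(maximalRealSubfield L)) W.1.asIdeal ∧ μ.IsUnramifiedAt W.1) →
      (3 ≤ Module.finrank ℚ ↥(maximalRealSubfield L)) →
      StSpectralHypAt L μ ξ v :=
  fun L _ _ _ μ ξ v hunr h3 => stSpectralHypAt_of_st1383At L μ ξ v (hU L μ ξ v hunr h3)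

end Summit.HodgeConjecture.HodgeConjecture.Cruxes.H413.K2E1StSpectralHypAtOfSt1383At

end
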